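import Summits.KontsevichZagierPeriods.KontsevichZagierPeriods.Theorems.LinRedNormalFormArrangementNormalFormStubRebaseSimpleZeroNestedDiffE1VertexWedge

/-!
# Stub `stub_rebaseSimpleZeroTwo`, part `rebaseSimpleZero_HDiff1_of_HPar1` (crux
`ArrangementNormalForm`, line `janus-bands`) — brick `NestedDiffE1VertexPole`

**A pinch vertex carrying the BASE POLE, letters off the vertex: the separable directions.** For a
datum of the interval normal form `HDiff₁` (`RebaseE1.IsDN`, base constant `K ≠ 0`) pinching at the
left end `l` with the base pole AT the vertex (`r = l`) and both letters off it, a box-Janus through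
the vertex converges as soon as its box has slices shrinking to the vertex (`|f| ≤ C/(y − l)` with
both fibres in a cone `|tₗ − t₀| ≤ γ (y − l)`: then `1/(y − l) ≤ γ/√(|tᵢ − t₀| |tⱼ − t₀|)`, the
wedge estimate in the frame `(y, tᵢ, tⱼ)`):
* `A' > 0` (`IsDN.good_vtx_pole_up`): sub-section Janus at the constant `t₀` THROUGH the vertex;
* `λ > B'` (`IsDN.good_vtx_pole_par`): super-section Janus at the `cⱼ`-parallel section through
  the vertex.
The remaining directions (`λ ≤ A' < B' ≤ 0` after the free three-piece cuts) are the type-S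
residue of the assembly. Also: letter margins with `η ≤ |c − t₀|` (`inner_margin'`,
`outer_margin'`) and the pole form of the wedge bound (`wedge_bound_pole`). Registered:
`rebaseSimpleZero_E1vertexPoleUp`.

References: M. Kontsevich, D. Zagier, *Periods* (2001), §1.2, rules (1a), (2).
-/

noncomputable section

open Set MeasureTheory MvPolynomial
open Literature.NumberTheory.Transcendental Literature.ModelTheory.ExponentialFields

namespace Summit.KontsevichZagierPeriods.ArrangementNormalForm.JanusBands

namespace RebaseE1

open SeparatePos RebasePos RebaseZero RebaseNest RebaseDiff

variable {i j : Fin 2} {s : KZ.IntegralRep (0 + 1 + 2)} {l u : ℚ} {A B : Cf} {T : BData}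
  {p : MvPolynomial (Fin 0) ℚ} {a : Fin 2 → Option Cf} {ci cj : Cf}

/-! ### Margins and the pole form of the wedge bound -/

/-- A letter at distance `≥ η` from the vertex level `t₀` keeps the distance `3η/8` from every `t`
with `t₀ − 5η/8 < t < t₀ + 5η/8`. [folklore] -/
theorem inner_margin' {c t₀ η ti : ℝ} (hη : η ≤ |c - t₀|) (hlo : t₀ - 5 * η / 8 < ti) (hhi : ti < t₀ + 5 * η / 8) :
    3 * η / 8 ≤ |ti - c| := by
  rcases le_or_gt c t₀ with hc | hc
  · rw [abs_of_nonpos (by linarith)] at hη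
    rw [abs_of_pos (by linarith)]
    linarith
  · rw [abs_of_pos (by linarith)] at hη
    rw [abs_of_neg (by linarith)]
    linarith

/-- A sloped letter `e + w` (`|w| ≤ η/8`) at distance `≥ η` from the vertex level keeps the distance
`η/4` from every `t` with `t₀ − 3η/8 < t < t₀ + 5η/8`. [folklore] -/
theorem outer_margin' {e t₀ η w t : ℝ} (hη : η ≤ |e - t₀|) (hw : |w| ≤ η / 8) (hlo : t₀ - 3 * η / 8 < t)
    (hhi : t < t₀ + 5 * η / 8) : η / 4 ≤ |t - (e + w)| := by
  obtain ⟨hw1, hw2⟩ := abs_le.1 hw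
  rcases le_or_gt e t₀ with hc | hc
  · rw [abs_of_nonpos (by linarith)] at hη
    rw [abs_of_pos (by linarith)]
    linarith
  · rw [abs_of_pos (by linarith)] at hη
    rw [abs_of_neg (by linarith)]
    linarith

/-- The pole form of the wedge bound: margins `gᵢ, gⱼ` for the two letters and a square-root trade
`1/|Y| ≤ C/S` for the base pole. [folklore] -/
theorem wedge_bound_pole {K Y P Q gi gj C S : ℝ} (hgi : 0 < gi) (hgj : 0 < gj) (hC : 0 ≤ C) (hS : 0 < S)
    (hY : 1 / |Y| ≤ C / S) (hP : gi ≤ |P|) (hQ : gj ≤ |Q|) :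
    |K| * (1 / |Y|) * ((1 / |P|) * (1 / |Q|)) ≤ (|K| * C / (gi * gj)) / S := by
  have e1 : 1 / |P| ≤ 1 / gi := one_div_le_one_div_of_le hgi hP
  have e2 : 1 / |Q| ≤ 1 / gj := one_div_le_one_div_of_le hgj hQ
  calc |K| * (1 / |Y|) * ((1 / |P|) * (1 / |Q|)) ≤ |K| * (C / S) * ((1 / gi) * (1 / gj)) :=
        mul_le_mul (mul_le_mul_of_nonneg_left hY (abs_nonneg K)) (mul_le_mul e1 e2 (by positivity) (by positivity))
          (by positivity) (by positivity)
    _ = (|K| * C / (gi * gj)) / S := by field_simp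

/-- The square-root trade for the pole: if `|L₁|, |L₂| ≤ γ Y` (`Y > 0`) then
`1/Y ≤ γ/(√|L₁| √|L₂|)` (off `L₁ L₂ = 0`). [folklore] -/
theorem one_div_le_sqrt_pole {Y L₁ L₂ γ : ℝ} (hY : 0 < Y) (hγ : 0 ≤ γ) (h1 : L₁ ≠ 0) (h2 : L₂ ≠ 0)
    (hL₁ : |L₁| ≤ γ * Y) (hL₂ : |L₂| ≤ γ * Y) : 1 / |Y| ≤ γ / (Real.sqrt |L₁| * Real.sqrt |L₂|) := by
  rw [abs_of_pos hY]
  refine one_div_le_sqrt hY h1 h2 ?_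
  have hs1 : Real.sqrt |L₁| ≤ Real.sqrt (γ * Y) := Real.sqrt_le_sqrt hL₁
  have hs2 : Real.sqrt |L₂| ≤ Real.sqrt (γ * Y) := Real.sqrt_le_sqrt hL₂
  calc Real.sqrt |L₁| * Real.sqrt |L₂| ≤ Real.sqrt (γ * Y) * Real.sqrt (γ * Y) :=
        mul_le_mul hs1 hs2 (Real.sqrt_nonneg _) (Real.sqrt_nonneg _)
    _ = γ * Y := Real.mul_self_sqrt (by positivity)

/-! ### The band opens upwards: sub-section Janus at `t₀` -/

/-- **Pole at the vertex, letters off it, `A' > 0`.** Sub-section Janus at the constant `t₀`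
through the vertex after the base cut; the box `{t₀ < tᵢ < tⱼ < B}` has slices shrinking to the
vertex and converges by the wedge estimate in the frame `(y, tᵢ, tⱼ)`.
[Kontsevich–Zagier 2001, §1.2, rules (1a), (2)] -/
theorem IsDN.good_vtx_pole_up (h : IsDN s l u A B T p a i j) (hL : LData T a i j ci cj)
    (hP : HParS T p a i j ci cj) (hK : Kc T p ≠ 0) (hpinch : evq A l = evq B l) (hpole : T.ℓ₂.2 = l)
    (hci : ci.2 ≠ evq A l) (hcj : evq cj l ≠ evq A l) (hαpos : 0 < A.1 (Fin.last 0))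
    (hreg : evq A u < evq B u) : Good 2 (KZ.of s) := by
  have hij := h.ne
  have hadm : T.n₁ = 0 ∨ T.n₂ = 0 := Or.inl hL.n1
  -- constants
  set t₀ : ℚ := evq A l with ht₀
  set α : ℚ := A.1 (Fin.last 0) with hα
  set β : ℚ := B.1 (Fin.last 0) with hβ
  set lam : ℚ := cj.1 (Fin.last 0) with hlamdef
  set η : ℚ := min |ci.2 - t₀| |evq cj l - t₀| with hη
  have hη0 : 0 < η := lt_min (abs_pos.2 (sub_ne_zero.2 hci)) (abs_pos.2 (sub_ne_zero.2 hcj))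
  have hηi : η ≤ |ci.2 - t₀| := min_le_left _ _
  have hηj : η ≤ |evq cj l - t₀| := min_le_right _ _
  obtain ⟨δ, hδ0, hqu, -, hβδ, hlamδ⟩ := exists_mesh h.lu α β lam hη0
  have hlq : l < l + δ := by linarith
  have hβpos : 0 < β := hαpos.trans (h.slope_lt hpinch)
  -- cut at `l + δ`; the right piece is regular
  refine h.good_split (l + δ) hlq hqu (fun s₁ h₁ => ?_) fun s₂ h₂ =>
    h₂.good_middle hL hP hK (h.evq_lt hlq hqu) hreg (Or.inl (by rw [hpole]; exact hlq))
  -- real bookkeeping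
  have hη0R : (0 : ℝ) < η := by exact_mod_cast hη0
  have hηiR : (η : ℝ) ≤ |(ci.2 : ℝ) - t₀| := by rw [← Rat.cast_sub, ← Rat.cast_abs]; exact_mod_cast hηi
  have hηjR : (η : ℝ) ≤ |(evq cj l : ℝ) - t₀| := by rw [← Rat.cast_sub, ← Rat.cast_abs]; exact_mod_cast hηj
  have hβδR : |(β : ℝ)| * δ ≤ η / 8 := by rw [← Rat.cast_abs]; exact_mod_cast hβδ
  have hlamδR : |(lam : ℝ)| * δ ≤ η / 8 := by rw [← Rat.cast_abs]; exact_mod_cast hlamδ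
  have hαR : (0 : ℝ) < α := by exact_mod_cast hαpos
  have hβR : (0 : ℝ) < β := by exact_mod_cast hβpos
  have hA : ∀ y : ℝ, ev A y = t₀ + α * (y - l) := fun y => by rw [ev_pinch A l]
  have hB : ∀ y : ℝ, ev B y = t₀ + β * (y - l) := fun y => by rw [ev_pinch B l, ← hpinch]
  have hC : ∀ y : ℝ, ev cj y = evq cj l + lam * (y - l) := fun y => by rw [ev_pinch cj l]
  have hrl : (T.ℓ₂.2 : ℝ) = l := by exact_mod_cast hpole
  -- the section
  set X : Cf := RebaseZero.mk 0 t₀ with hX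
  have hXv : ∀ y : ℝ, ev X y = t₀ := fun y => by rw [hX, ev_mk_zero]
  have hXA : ∀ y : ℝ, (l : ℝ) < y → y < ((l + δ : ℚ) : ℝ) → ev X y < ev A y := fun y h1 _ => by
    rw [hXv, hA]; nlinarith
  -- the box converges
  have hWW : IntegrableOn (glitB T p a)
      (gDom 0 2 2 ![RebaseZero.mk 1 (-l), RebaseZero.mk (-1) (l + δ)] (nlo i X) (nhi j B)) := by
    refine integrableOn_of_wedge (isSemialgebraic_gDom _ _ _ _) (isBounded_nDom_Ioo hij l (l + δ) _ _)
      (isSemialgebraicFunOn_glit (isSemialgebraic_gDom _ _ _ _) _ _ _ _ _ _ _ _) (wLinT i j (0 : ℝ))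
      (wLinT_det_ne hij _) (t₀ : ℝ) (t₀ : ℝ) (|Kc T p| * β / ((3 * η / 8) * (η / 4)))
      fun z hz hz1 hz2 => ?_
    obtain ⟨-, e1, e2⟩ := wLinT_apply i j (0 : ℝ) z
    rw [e1] at hz1 ⊢
    rw [e2] at hz2 ⊢
    rw [mem_nDom_Ioo hij] at hz
    obtain ⟨⟨hy1, hy2⟩, h3, h4, h5⟩ := hz
    push_cast at hy2
    rw [hXv] at h3
    rw [hB] at h5
    -- the three factors
    have hβy := (abs_le.1 (abs_slope_mul_le hβδR hy1 hy2)).2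
    have hlamy := abs_slope_mul_le hlamδR hy1 hy2
    have hgi : 3 * (η : ℝ) / 8 ≤ |tv z i - ev ci (yv z)| := by
      rw [ev_of_fst_eq_zero hL.ci0]
      exact inner_margin' hηiR (by linarith) (by linarith)
    have hgj : (η : ℝ) / 4 ≤ |tv z j - ev cj (yv z)| := by
      rw [hC]
      exact outer_margin' hηjR hlamy (by linarith) (by linarith)
    have hY0 : 0 < yv z - l := by linarith
    have hL1 : |tv z i - 0 * yv z - t₀| ≤ β * (yv z - l) := by
      rw [zero_mul, sub_zero, abs_of_pos (by linarith)]; linarith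
    have hL2 : |tv z j - 0 * yv z - t₀| ≤ β * (yv z - l) := by
      rw [zero_mul, sub_zero, abs_of_pos (by linarith)]; linarith
    have hY : 1 / |yv z - T.ℓ₂.2| ≤ β / (Real.sqrt |tv z i - 0 * yv z - t₀| * Real.sqrt |tv z j - 0 * yv z - t₀|) := by
      rw [hrl]
      exact one_div_le_sqrt_pole hY0 hβR.le (sub_ne_zero.2 hz1) (sub_ne_zero.2 hz2) hL1 hL2
    have hS : 0 < Real.sqrt |tv z i - 0 * yv z - t₀| * Real.sqrt |tv z j - 0 * yv z - t₀| :=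
      mul_pos (Real.sqrt_pos.2 (abs_pos.2 (sub_ne_zero.2 hz1))) (Real.sqrt_pos.2 (abs_pos.2 (sub_ne_zero.2 hz2)))
    rw [abs_glitB hL p z]
    exact wedge_bound_pole (by positivity) (by positivity) hβR.le hS hY hgi hgj
  have fT : X.1 (Fin.last 0) = ci.1 (Fin.last 0) := by rw [hX, mk_fst, hL.ci0]
  exact h₁.good_sub hadm X hXA hWW (fun W hW' => hW'.good_par hP (Or.inl fT)) fun r₁ hr₁ =>
    hr₁.good_par hP (Or.inl fT)

/-! ### The letter direction above the band: super-section Janus through the vertex -/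

/-- **Pole at the vertex, letters off it, `λ > B'`.** Super-section Janus at the `cⱼ`-parallel
section through the vertex after the base cut; the box `{A < tᵢ < tⱼ < t₀ + λ(y − l)}` has slices
shrinking to the vertex and converges by the wedge estimate in the frame `(y, tᵢ, tⱼ)`.
[Kontsevich–Zagier 2001, §1.2, rules (1a), (2)] -/
theorem IsDN.good_vtx_pole_par (h : IsDN s l u A B T p a i j) (hL : LData T a i j ci cj)
    (hP : HParS T p a i j ci cj) (hK : Kc T p ≠ 0) (hpinch : evq A l = evq B l) (hpole : T.ℓ₂.2 = l)
    (hci : ci.2 ≠ evq A l) (hcj : evq cj l ≠ evq A l) (hlam : B.1 (Fin.last 0) < cj.1 (Fin.last 0))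
    (hreg : evq A u < evq B u) : Good 2 (KZ.of s) := by
  have hij := h.ne
  have hadm : T.n₁ = 0 ∨ T.n₂ = 0 := Or.inl hL.n1
  -- constants
  set t₀ : ℚ := evq A l with ht₀
  set α : ℚ := A.1 (Fin.last 0) with hα
  set β : ℚ := B.1 (Fin.last 0) with hβ
  set lam : ℚ := cj.1 (Fin.last 0) with hlamdef
  set η : ℚ := min |ci.2 - t₀| |evq cj l - t₀| with hη
  have hη0 : 0 < η := lt_min (abs_pos.2 (sub_ne_zero.2 hci)) (abs_pos.2 (sub_ne_zero.2 hcj))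
  have hηi : η ≤ |ci.2 - t₀| := min_le_left _ _
  have hηj : η ≤ |evq cj l - t₀| := min_le_right _ _
  obtain ⟨δ, hδ0, hqu, hαδ, -, hlamδ⟩ := exists_mesh h.lu α β lam hη0
  have hlq : l < l + δ := by linarith
  -- cut at `l + δ`; the right piece is regular
  refine h.good_split (l + δ) hlq hqu (fun s₁ h₁ => ?_) fun s₂ h₂ =>
    h₂.good_middle hL hP hK (h.evq_lt hlq hqu) hreg (Or.inl (by rw [hpole]; exact hlq))
  -- real bookkeeping
  have hη0R : (0 : ℝ) < η := by exact_mod_cast hη0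
  have hηiR : (η : ℝ) ≤ |(ci.2 : ℝ) - t₀| := by rw [← Rat.cast_sub, ← Rat.cast_abs]; exact_mod_cast hηi
  have hηjR : (η : ℝ) ≤ |(evq cj l : ℝ) - t₀| := by rw [← Rat.cast_sub, ← Rat.cast_abs]; exact_mod_cast hηj
  have hαδR : |(α : ℝ)| * δ ≤ η / 8 := by rw [← Rat.cast_abs]; exact_mod_cast hαδ
  have hlamδR : |(lam : ℝ)| * δ ≤ η / 8 := by rw [← Rat.cast_abs]; exact_mod_cast hlamδ
  have hκ : (β : ℝ) < lam := by exact_mod_cast hlam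
  have hA : ∀ y : ℝ, ev A y = t₀ + α * (y - l) := fun y => by rw [ev_pinch A l]
  have hB : ∀ y : ℝ, ev B y = t₀ + β * (y - l) := fun y => by rw [ev_pinch B l, ← hpinch]
  have hC : ∀ y : ℝ, ev cj y = evq cj l + lam * (y - l) := fun y => by rw [ev_pinch cj l]
  have hrl : (T.ℓ₂.2 : ℝ) = l := by exact_mod_cast hpole
  -- the section
  set Z : Cf := RebaseZero.mk lam (t₀ - lam * l) with hZ
  have hZv : ∀ y : ℝ, ev Z y = t₀ + lam * (y - l) := fun y => by rw [hZ, ev_mk]; push_cast; ring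
  have hBZ : ∀ y : ℝ, (l : ℝ) < y → y < ((l + δ : ℚ) : ℝ) → ev B y < ev Z y := fun y h1 _ => by
    rw [hZv, hB]; nlinarith
  -- the box converges
  set γ : ℝ := |(α : ℝ)| + |(lam : ℝ)| with hγ
  have hγ0 : 0 ≤ γ := by positivity
  have hWW : IntegrableOn (glitB T p a)
      (gDom 0 2 2 ![RebaseZero.mk 1 (-l), RebaseZero.mk (-1) (l + δ)] (nlo i A) (nhi j Z)) := by
    refine integrableOn_of_wedge (isSemialgebraic_gDom _ _ _ _) (isBounded_nDom_Ioo hij l (l + δ) _ _)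
      (isSemialgebraicFunOn_glit (isSemialgebraic_gDom _ _ _ _) _ _ _ _ _ _ _ _) (wLinT i j (0 : ℝ))
      (wLinT_det_ne hij _) (t₀ : ℝ) (t₀ : ℝ) (|Kc T p| * γ / ((3 * η / 8) * (η / 4)))
      fun z hz hz1 hz2 => ?_
    obtain ⟨-, e1, e2⟩ := wLinT_apply i j (0 : ℝ) z
    rw [e1] at hz1 ⊢
    rw [e2] at hz2 ⊢
    rw [mem_nDom_Ioo hij] at hz
    obtain ⟨⟨hy1, hy2⟩, h3, h4, h5⟩ := hz
    push_cast at hy2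
    rw [hA] at h3
    rw [hZv] at h5
    -- the three factors
    have hαy := abs_le.1 (abs_slope_mul_le hαδR hy1 hy2)
    have hlamy := abs_slope_mul_le hlamδR hy1 hy2
    have hlamy' := abs_le.1 hlamy
    have hgi : 3 * (η : ℝ) / 8 ≤ |tv z i - ev ci (yv z)| := by
      rw [ev_of_fst_eq_zero hL.ci0]
      exact inner_margin' hηiR (by linarith) (by linarith)
    have hgj : (η : ℝ) / 4 ≤ |tv z j - ev cj (yv z)| := by
      rw [hC]
      exact outer_margin' hηjR hlamy (by linarith) (by linarith)
    have hY0 : 0 < yv z - l := by linarith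
    have hlo : -(γ * (yv z - l)) ≤ α * (yv z - l) := by
      rw [hγ]
      have := neg_abs_le (α : ℝ)
      nlinarith [abs_nonneg (lam : ℝ)]
    have hhi : (lam : ℝ) * (yv z - l) ≤ γ * (yv z - l) := by
      rw [hγ]
      have := le_abs_self (lam : ℝ)
      nlinarith [abs_nonneg (α : ℝ)]
    have hL1 : |tv z i - 0 * yv z - t₀| ≤ γ * (yv z - l) := by
      rw [zero_mul, sub_zero, abs_le]; constructor <;> linarith
    have hL2 : |tv z j - 0 * yv z - t₀| ≤ γ * (yv z - l) := by
      rw [zero_mul, sub_zero, abs_le]; constructor <;> linarith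
    have hY : 1 / |yv z - T.ℓ₂.2| ≤ γ / (Real.sqrt |tv z i - 0 * yv z - t₀| * Real.sqrt |tv z j - 0 * yv z - t₀|) := by
      rw [hrl]
      exact one_div_le_sqrt_pole hY0 hγ0 (sub_ne_zero.2 hz1) (sub_ne_zero.2 hz2) hL1 hL2
    have hS : 0 < Real.sqrt |tv z i - 0 * yv z - t₀| * Real.sqrt |tv z j - 0 * yv z - t₀| :=
      mul_pos (Real.sqrt_pos.2 (abs_pos.2 (sub_ne_zero.2 hz1))) (Real.sqrt_pos.2 (abs_pos.2 (sub_ne_zero.2 hz2)))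
    rw [abs_glitB hL p z]
    exact wedge_bound_pole (by positivity) (by positivity) hγ0 hS hY hgi hgj
  have fT : Z.1 (Fin.last 0) = cj.1 (Fin.last 0) := by rw [hZ, mk_fst]
  exact h₁.good_sup hadm Z hBZ hWW (fun W hW' => hW'.good_par hP (Or.inr fT)) fun r₃ hr₃ =>
    hr₃.good_par hP (Or.inr fT)

end RebaseE1

/-- **Registered brick `rebaseSimpleZero_E1vertexPoleUp`** (part `rebaseSimpleZero_HDiff1_of_HPar1` of
`stub_rebaseSimpleZeroTwo`, line `janus-bands`): a datum of the interval normal form `HDiff₁`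
(`RebaseE1.IsDN`) with non-zero base constant which pinches at the left end with the base pole AT
the pinch vertex, both letters off the vertex and the band opening upwards (`A' > 0`), with a
regular right end, is congruent modulo `KZ.relations` to the subgroup generated by `GG 0 2 2`,
given `HPar1` (`RebaseE1.IsDN.good_vtx_pole_up`: base cut, sub-section Janus at the constant `t₀`
through the vertex, wedge estimate on the shrinking box). [Kontsevich–Zagier 2001, §1.2] -/
theorem rebaseSimpleZero_E1vertexPoleUp (i j : Fin 2) (s : KZ.IntegralRep (0 + 1 + 2)) (l u : ℚ) (A B ci cj : (Fin (0 + 1) → ℚ) × ℚ) (T : RebaseZero.BData) (p : MvPolynomial (Fin 0) ℚ) (a : Fin 2 → Option ((Fin (0 + 1) → ℚ) × ℚ)) (h : RebaseE1.IsDN s l u A B T p a i j) (hL : RebaseE1.LData T a i j ci cj) (hP : RebaseE1.HParS T p a i j ci cj) (hK : RebaseDiff.Kc T p ≠ 0) (hpinch : RebaseE1.evq A l = RebaseE1.evq B l) (hpole : T.ℓ₂.2 = l) (hci : ci.2 ≠ RebaseE1.evq A l) (hcj : RebaseE1.evq cj l ≠ RebaseE1.evq A l) (hαpos : 0 < A.1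 (Fin.last 0)) (hreg : RebaseE1.evq A u < RebaseE1.evq B u) : RebaseZero.Good 2 (KZ.of s) :=
  h.good_vtx_pole_up hL hP hK hpinch hpole hci hcj hαpos hreg

end Summit.KontsevichZagierPeriods.ArrangementNormalForm.JanusBands
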